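import Summits.NavierStokesRegularity.NavierStokesRegularity.Theorems.DssFarFieldSlavingBlowupTypeIDssProfileSmoothRepresentativeAe
import Summits.NavierStokesRegularity.NavierStokesRegularity.Theorems.DssFarFieldSlavingBlowupTypeIDssProfileFiniteOrderTwist
import Summits.NavierStokesRegularity.NavierStokesRegularity.Theorems.RellichScarScarRigidityApexBounds
import Literature.Analysis.FluidPDE.AncientSimilarityVariables
import Literature.Barriers.NavierStokesRegularity.NearOneDssTypeIExclusion
import HarnessLib

/-!
# From the duality-form class to classical similarity profiles at the SAME constant, and the
  class-level forms of the classical exclusion theorems (route `DssFarFieldSlaving`, crux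
  `BlowupTypeIDssProfile`, stmt-NavierStokesRegularity-0155 — SUPPORT; cell pub-ns-dss,
  HOME/LIOUVILLE-SIDE.md T3 `ProfileToClass`, T5′ `SmallConstantControl`, T14 `NearIdentityControl`)

A member `(c, R, u)` of the hypothesis class of the truncation bridges (ancient mild with `ν = 1`,
measurable slices, rotated `c`-DSS for `R`, `‖u(t,x)‖ ≤ C₀/(‖x‖ + √(−t))`) has, by the level-`C₀`
representative `rdssClass_smoothRepresentative_ae` and the glued Fabes–Jones–Rivière pressure
`RellichScarScarRigidity.exists_isClassicalNSSolutionOn_Iio`, a CLASSICAL representative `(V, P)` on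
`(−∞, 0) × ℝ³` with the same `(c, R, C₀)` and `V t = u t` a.e. for every `t < 0`
(`rdssClass_classicalRepresentative`); its similarity orbit `U = lerayOrbit V` solves the backward
Leray system on `ℝ × ℝ³`, is twisted-periodic `U(s + 2 log c, y) = R⁻¹U(s, Ry)` and obeys
`(1 + ‖y‖)‖U(s,y)‖ ≤ C₀` (`rdssClass_lerayProfile`).  Consequences:

* `rdssClass_ae_zero_of_profileLiouville` — if every such classical profile at `(c, R, C₀)`
  vanishes identically then every class member at `(c, R, C₀)` is a.e. zero on every slice; and the
  symmetric form `rdssClass_ae_zero_of_profileLiouville_equivariant`: a.e. equivariance of the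
  slices of `u` under a set `G` of isometries becomes POINTWISE equivariance of the profile
  (`equivariant_of_ae_equivariant`), so it suffices that every `G`-equivariant profile vanishes —
  the matrix of the cell's `ProfileToClass`;
* `rdssClass_removing_finiteOrder` — Chae–Wolf 2017 Thm 1.3 at the class level, for twists of
  finite order `R ^ q = 1` at the factor `c ^ q` (through `rdss_finiteOrder_removing`);
* `rdssClass_smallConstant_ae_zero` — the absolute small-constant exclusion at the class level
  (through `Literature.Barriers.NavierStokesRegularity.ancient_typeI_smallConstant_eq_zero`), no
  self-similarity needed.

## References

* G. Koch, N. Nadirashvili, G. Seregin, V. Šverák, Acta Math. 203 (2009), §4, Thm 6.1.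
  [KochNadirashviliSereginSverak2009]
* E. B. Fabes, B. F. Jones, N. M. Rivière, ARMA 45 (1972), Thm 2.1. [FabesJonesRiviere1972]
* D. Chae, J. Wolf, Comm. PDE 42 (2017), Thm 1.3 and Remark 1.4. [ChaeWolf2017RemovingDSS]
-/

noncomputable section

set_option linter.dupNamespace false

namespace Summit.NavierStokesRegularity.NavierStokesRegularity.Theorems

open MeasureTheory Set Function Literature.Analysis.FluidPDE

/-- **Classical representative of a Type-I ancient mild solution on the whole past, same constant**
(no self-similarity): `IsTypeIAncientMild C₀ V`, a jointly smooth pressure `P` with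
`IsClassicalNSSolutionOn (Iio 0) 1 0 V P` (KNSS §4 smoothing + Fabes–Jones–Rivière window pressures,
glued: `RellichScarScarRigidity.exists_isClassicalNSSolutionOn_Iio`), `HasTypeIDecay C₀ V`,
`V t = u t` a.e. for every `t < 0`, `V = 0` for `t ≥ 0`. [cite: FabesJonesRiviere1972, Thm 2.1] -/
theorem typeI_ancient_classicalRepresentative
    {u : ℝ → EuclideanSpace ℝ (Fin 3) → EuclideanSpace ℝ (Fin 3)} {C₀ : ℝ}
    (hu : IsAncientMildSolution 1 u) (hmeas : ∀ t < 0, AEStronglyMeasurable (u t) volume)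
    (hC : HasTypeIDecay C₀ u) :
    ∃ (V : ℝ → EuclideanSpace ℝ (Fin 3) → EuclideanSpace ℝ (Fin 3)) (P : ℝ → EuclideanSpace ℝ (Fin 3) → ℝ),
      IsTypeIAncientMild C₀ V ∧ IsClassicalNSSolutionOn (Iio 0) 1 0 V P ∧ HasTypeIDecay C₀ V ∧
      (∀ t < 0, V t =ᵐ[volume] u t) ∧ (∀ t, 0 ≤ t → ∀ x, V t x = 0) := by
  obtain ⟨V, hT, hdec, hVu, hV0⟩ := typeI_ancient_smoothRepresentative_ae hu hmeas hC
  obtain ⟨P, hP⟩ := RellichScarScarRigidity.exists_isClassicalNSSolutionOn_Iio hT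
  exact ⟨V, P, hT, hP, hdec, hVu, hV0⟩

/-- **Classical representative of a member of the Type-I rotated-DSS class**, same `(c, R, C₀)`,
a.e.-equal slices. [cite: KochNadirashviliSereginSverak2009, §4] -/
theorem rdssClass_classicalRepresentative {c : ℝ} (hc : 1 < c)
    {R : EuclideanSpace ℝ (Fin 3) ≃ₗᵢ[ℝ] EuclideanSpace ℝ (Fin 3)}
    {u : ℝ → EuclideanSpace ℝ (Fin 3) → EuclideanSpace ℝ (Fin 3)} {C₀ : ℝ}
    (hu : IsAncientMildSolution 1 u) (hmeas : ∀ t < 0, AEStronglyMeasurable (u t) volume)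
    (hdss : IsRotatedDSS c R u) (hC : HasTypeIDecay C₀ u) :
    ∃ (V : ℝ → EuclideanSpace ℝ (Fin 3) → EuclideanSpace ℝ (Fin 3)) (P : ℝ → EuclideanSpace ℝ (Fin 3) → ℝ),
      IsTypeIAncientMild C₀ V ∧ IsClassicalNSSolutionOn (Iio 0) 1 0 V P ∧ IsRotatedDSS c R V ∧
      HasTypeIDecay C₀ V ∧ (∀ t < 0, V t =ᵐ[volume] u t) ∧ (∀ t, 0 ≤ t → ∀ x, V t x = 0) := by
  obtain ⟨V, hT, hR, hdec, hVu, hV0⟩ := rdssClass_smoothRepresentative_ae hc hu hmeas hdss hC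
  obtain ⟨P, hP⟩ := RellichScarScarRigidity.exists_isClassicalNSSolutionOn_Iio hT
  exact ⟨V, P, hT, hP, hR, hdec, hVu, hV0⟩

/-- Slices of a classical solution on the past are continuous. [folklore] -/
theorem continuous_slice_of_isClassicalNSSolutionOn_Iio {ν : ℝ}
    {V f : ℝ → EuclideanSpace ℝ (Fin 3) → EuclideanSpace ℝ (Fin 3)} {P : ℝ → EuclideanSpace ℝ (Fin 3) → ℝ}
    (hP : IsClassicalNSSolutionOn (Iio 0) ν f V P) {t : ℝ} (ht : t < 0) : Continuous (V t) :=
  (hP.contDiff_velocity (show t ∈ Iio (0 : ℝ) from ht)).continuous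

/-- **The classical similarity profile of a class member** (same `(c, R, C₀)`): `U = lerayOrbit V`
of the classical representative solves the backward Leray system on `ℝ × ℝ³`
(`isClassicalNSSolutionOn_Iio_iff_isBackwardLeraySolutionOn`), is twisted-periodic
(`IsRotatedDSS.lerayOrbit_add_period`) and obeys the profile Type-I bound
(`hasTypeIDecay_iff_lerayOrbit`); `V` has continuous slices a.e. equal to those of `u`.
[cite: KochNadirashviliSereginSverak2009, §4] -/
theorem rdssClass_lerayProfile {c : ℝ} (hc : 1 < c)
    {R : EuclideanSpace ℝ (Fin 3) ≃ₗᵢ[ℝ] EuclideanSpace ℝ (Fin 3)}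
    {u : ℝ → EuclideanSpace ℝ (Fin 3) → EuclideanSpace ℝ (Fin 3)} {C₀ : ℝ}
    (hu : IsAncientMildSolution 1 u) (hmeas : ∀ t < 0, AEStronglyMeasurable (u t) volume)
    (hdss : IsRotatedDSS c R u) (hC : HasTypeIDecay C₀ u) :
    ∃ (V : ℝ → EuclideanSpace ℝ (Fin 3) → EuclideanSpace ℝ (Fin 3)) (Q : ℝ → EuclideanSpace ℝ (Fin 3) → ℝ),
      IsBackwardLeraySolutionOn univ 1 (lerayOrbit V) Q ∧
      (∀ s y, lerayOrbit V (s + 2 * Real.log c) y = R.symm (lerayOrbit V s (R y))) ∧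
      (∀ s y, (1 + ‖y‖) * ‖lerayOrbit V s y‖ ≤ C₀) ∧
      (∀ t < 0, Continuous (V t)) ∧ (∀ t < 0, V t =ᵐ[volume] u t) := by
  obtain ⟨V, P, -, hP, hR, hdec, hVu, -⟩ := rdssClass_classicalRepresentative hc hu hmeas hdss hC
  refine ⟨V, lerayOrbitPressure P, isClassicalNSSolutionOn_Iio_iff_isBackwardLeraySolutionOn.1 hP,
    fun s y => hR.lerayOrbit_add_period (by linarith) s y, hasTypeIDecay_iff_lerayOrbit.1 hdec,
    fun t ht => continuous_slice_of_isClassicalNSSolutionOn_Iio hP ht, hVu⟩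

/-- **Profile Liouville ⇒ class Liouville at the same `(c, R, C₀)`**: if every classical solution
`(U, Q)` of the backward Leray system on `ℝ × ℝ³` that is twisted-periodic for `(c, R)` and obeys
`(1 + ‖y‖)‖U‖ ≤ C₀` vanishes identically, then every member of the duality-form class at
`(c, R, C₀)` is a.e. zero on every slice `t < 0` (its classical profile vanishes, so its classical
representative vanishes on the past, and the slices of `u` agree with it a.e.).
[cite: KochNadirashviliSereginSverak2009, §4] -/
theorem rdssClass_ae_zero_of_profileLiouville {c : ℝ}
    {R : EuclideanSpace ℝ (Fin 3) ≃ₗᵢ[ℝ] EuclideanSpace ℝ (Fin 3)} {C₀ : ℝ}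
    (hprof : ∀ (U : ℝ → EuclideanSpace ℝ (Fin 3) → EuclideanSpace ℝ (Fin 3))
      (Q : ℝ → EuclideanSpace ℝ (Fin 3) → ℝ), IsBackwardLeraySolutionOn univ 1 U Q →
      (∀ s y, U (s + 2 * Real.log c) y = R.symm (U s (R y))) →
      (∀ s y, (1 + ‖y‖) * ‖U s y‖ ≤ C₀) → ∀ s y, U s y = 0)
    {u : ℝ → EuclideanSpace ℝ (Fin 3) → EuclideanSpace ℝ (Fin 3)} (hc : 1 < c)
    (hu : IsAncientMildSolution 1 u) (hmeas : ∀ t < 0, AEStronglyMeasurable (u t) volume)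
    (hdss : IsRotatedDSS c R u) (hC : HasTypeIDecay C₀ u) : ∀ t < 0, u t =ᵐ[volume] 0 := by
  obtain ⟨V, Q, hL, hper, hI, -, hVu⟩ := rdssClass_lerayProfile hc hu hmeas hdss hC
  have hU0 : ∀ s y, lerayOrbit V s y = 0 := hprof _ Q hL hper hI
  intro t ht
  have hVt : V t = 0 := by
    funext x
    rw [eq_lerayOrbit_of_neg V ht x, hU0, smul_zero, Pi.zero_apply]
  have key := hVu t ht
  rw [hVt] at key
  exact key.symm

/-- **A.e. equivariance of the slices of `u` is pointwise equivariance of a continuous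
representative slice**: if `V t` is continuous, `V t = u t` a.e., and `u t (g x) = g (u t x)` for
a.e. `x` (a linear isometry `g`), then `V t (g y) = g (V t y)` for all `y` (`g` preserves null
sets, and continuous a.e.-equal functions are equal). [folklore] -/
theorem equivariant_of_ae_equivariant (g : EuclideanSpace ℝ (Fin 3) ≃ₗᵢ[ℝ] EuclideanSpace ℝ (Fin 3))
    {w v : EuclideanSpace ℝ (Fin 3) → EuclideanSpace ℝ (Fin 3)} (hv : Continuous v)
    (hvw : v =ᵐ[volume] w) (hw : (fun x => w (g x)) =ᵐ[volume] fun x => g (w x)) :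
    ∀ y, v (g y) = g (v y) := by
  have h1 : (fun x => v (g x)) =ᵐ[volume] fun x => w (g x) :=
    g.measurePreserving.quasiMeasurePreserving.ae_eq hvw
  have h2 : (fun x => g (w x)) =ᵐ[volume] fun x => g (v x) := by
    filter_upwards [hvw] with x hx
    rw [hx]
  have hae : (fun x => v (g x)) =ᵐ[volume] fun x => g (v x) := (h1.trans hw).trans h2
  exact congrFun (Measure.eq_of_ae_eq hae (hv.comp g.continuous) (g.continuous.comp hv))

/-- **Symmetric form (the matrix of the cell's `ProfileToClass`)**: let `G` be any set of linear
isometries.  If every classical twisted-periodic Type-I profile at `(c, R, C₀)` which is POINTWISE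
`G`-equivariant (`U s (g y) = g (U s y)`) vanishes identically, then every member of the class at
`(c, R, C₀)` whose slices are A.E. `G`-equivariant (`u t (g x) = g (u t x)` for a.e. `x`, every
`t < 0`, every `g ∈ G`) is a.e. zero on every slice. [cite: KochNadirashviliSereginSverak2009, §4] -/
theorem rdssClass_ae_zero_of_profileLiouville_equivariant
    (G : Set (EuclideanSpace ℝ (Fin 3) ≃ₗᵢ[ℝ] EuclideanSpace ℝ (Fin 3))) {c : ℝ}
    {R : EuclideanSpace ℝ (Fin 3) ≃ₗᵢ[ℝ] EuclideanSpace ℝ (Fin 3)} {C₀ : ℝ}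
    (hprof : ∀ (U : ℝ → EuclideanSpace ℝ (Fin 3) → EuclideanSpace ℝ (Fin 3))
      (Q : ℝ → EuclideanSpace ℝ (Fin 3) → ℝ), IsBackwardLeraySolutionOn univ 1 U Q →
      (∀ s y, U (s + 2 * Real.log c) y = R.symm (U s (R y))) →
      (∀ s y, (1 + ‖y‖) * ‖U s y‖ ≤ C₀) → (∀ g ∈ G, ∀ s y, U s (g y) = g (U s y)) →
      ∀ s y, U s y = 0)
    {u : ℝ → EuclideanSpace ℝ (Fin 3) → EuclideanSpace ℝ (Fin 3)} (hc : 1 < c)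
    (hu : IsAncientMildSolution 1 u) (hmeas : ∀ t < 0, AEStronglyMeasurable (u t) volume)
    (hdss : IsRotatedDSS c R u) (hC : HasTypeIDecay C₀ u)
    (hG : ∀ g ∈ G, ∀ t < 0, (fun x => u t (g x)) =ᵐ[volume] fun x => g (u t x)) :
    ∀ t < 0, u t =ᵐ[volume] 0 := by
  obtain ⟨V, Q, hL, hper, hI, hVc, hVu⟩ := rdssClass_lerayProfile hc hu hmeas hdss hC
  -- pointwise equivariance of the continuous representative, hence of its similarity orbit
  have hVeq : ∀ g ∈ G, ∀ t < 0, ∀ y, V t (g y) = g (V t y) := fun g hg t ht =>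
    equivariant_of_ae_equivariant g (hVc t ht) (hVu t ht) (hG g hg t ht)
  have hUeq : ∀ g ∈ G, ∀ s y, lerayOrbit V s (g y) = g (lerayOrbit V s y) := by
    intro g hg s y
    have ht : -Real.exp (-s) < 0 := by simpa using Real.exp_pos (-s)
    rw [lerayOrbit_apply, lerayOrbit_apply, ← g.map_smul, hVeq g hg _ ht, g.map_smul]
  have hU0 : ∀ s y, lerayOrbit V s y = 0 := hprof _ Q hL hper hI hUeq
  intro t ht
  have hVt : V t = 0 := by
    funext x
    rw [eq_lerayOrbit_of_neg V ht x, hU0, smul_zero, Pi.zero_apply]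
  have key := hVu t ht
  rw [hVt] at key
  exact key.symm

/-- **Chae–Wolf's fine-ratio exclusion at the CLASS level, finite-order twists included** (Chae–Wolf
2017 Thm 1.3 through `rdss_finiteOrder_removing` and the level-`C₀` classical representative): for
every `C₀ > 0` there is `c₁ > 1` such that every member `(c, R, u)` of the duality-form class with
Type-I constant `C₀`, `R ^ q = 1` (`0 < q`) and `c ^ q < c₁` is a.e. zero on every slice.  For
`q = 1`, `R = 1` this is the plain `λ`-DSS Liouville statement `TypeIDSSLiouville c` restricted to
the constant `C₀` and `1 < c < c₁(C₀)`. [cite: ChaeWolf2017RemovingDSS, Theorem 1.3 (arXiv:1610.09464 p. 3)] -/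
theorem rdssClass_removing_finiteOrder {C₀ : ℝ} (hC₀ : 0 < C₀) :
    ∃ c₁ : ℝ, 1 < c₁ ∧
      ∀ (c : ℝ) (R : EuclideanSpace ℝ (Fin 3) ≃ₗᵢ[ℝ] EuclideanSpace ℝ (Fin 3)) (q : ℕ)
        (u : ℝ → EuclideanSpace ℝ (Fin 3) → EuclideanSpace ℝ (Fin 3)),
        1 < c → R ^ q = 1 → 0 < q → c ^ q < c₁ →
        IsAncientMildSolution 1 u → (∀ t < 0, AEStronglyMeasurable (u t) volume) →
        IsRotatedDSS c R u → HasTypeIDecay C₀ u → ∀ t < 0, u t =ᵐ[volume] 0 := by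
  obtain ⟨c₁, hc₁, H⟩ := rdss_finiteOrder_removing hC₀
  refine ⟨c₁, hc₁, fun c R q u hc hRq hq hlt hu hmeas hdss hC t ht => ?_⟩
  obtain ⟨V, P, -, hP, hR, hdec, hVu, -⟩ := rdssClass_classicalRepresentative hc hu hmeas hdss hC
  have hV0 : V t = 0 := funext fun x => H c R q V P hc hRq hq hlt hP hR hdec t ht x
  have key := hVu t ht
  rw [hV0] at key
  exact key.symm

/-- **The absolute small-constant exclusion at the CLASS level** (Chae–Wolf 2017 Remark 1.4 in the
tree's form `ancient_typeI_smallConstant_eq_zero`): there is `ε₀ > 0` such that every ancient mild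
solution (`ν = 1`, measurable slices) with `‖u(t,x)‖ ≤ C₀/(‖x‖ + √(−t))`, `C₀ ≤ ε₀`, is a.e. zero
on every slice — NO self-similarity needed. [cite: ChaeWolf2017RemovingDSS, Remark 1.4 (arXiv:1610.09464 p. 3)] -/
theorem typeI_ancient_smallConstant_ae_zero :
    ∃ ε₀ : ℝ, 0 < ε₀ ∧ ∀ {C₀ : ℝ} {u : ℝ → EuclideanSpace ℝ (Fin 3) → EuclideanSpace ℝ (Fin 3)},
      C₀ ≤ ε₀ → IsAncientMildSolution 1 u → (∀ t < 0, AEStronglyMeasurable (u t) volume) →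
      HasTypeIDecay C₀ u → ∀ t < 0, u t =ᵐ[volume] 0 := by
  obtain ⟨ε₀, hε₀, H⟩ := Literature.Barriers.NavierStokesRegularity.ancient_typeI_smallConstant_eq_zero
  refine ⟨ε₀, hε₀, fun {C₀ u} hle hu hmeas hC t ht => ?_⟩
  obtain ⟨V, P, hT, hP, hdec, hVu, -⟩ := typeI_ancient_classicalRepresentative hu hmeas hC
  have hV0 : V t = 0 := funext fun x => H hT.nonneg hle hP hdec t ht x
  have key := hVu t ht
  rw [hV0] at key
  exact key.symm

end Summit.NavierStokesRegularity.NavierStokesRegularity.Theorems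

end
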